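import Summits.QuantumAdvantage.QuantumAdvantage.Theses.CubicForrelation
import Summits.QuantumAdvantage.QuantumAdvantage.Theorems.ExactPairsMaioranaMcFarland.Negative.DillonCertificate
import Literature.Computability.QuantumComplexity.ForrelationSignTransport

/-!
# Crux `CubicForrelation.ExactPairsMaioranaMcFarland` (stmt-QuantumAdvantage-2205) — stub `stub_dillon_normal_form`

Line `two-adic-local-nongeneric`, LAST stub of the composition `ExactPairsMaioranaMcFarland_of`: DILLON'S NORMAL FORM.
A bent `g` on `m + m` bits (`W_g(b) = 2^m (-1)^{f(b)}`, dual `f`) that is affine on every coset of an xor-closed `V`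
with `|V| = 2^m` (all second derivatives `D_a D_b g`, `a b ∈ V`, vanish) is completed Maiorana–McFarland in the crux's
own normal form: for a LINEAR bijection `e` (given with its matrix, translation `0`), a PERMUTATION `perm` of `𝔽₂^m`
and some `h`, `g(e(y′ ‖ y″)) = ⟨y′, perm y″⟩ + h(y″)` [J. F. Dillon, PhD thesis, Univ. of Maryland (1974);
C. Carlet, *Boolean Functions for Cryptography and Coding Theory* (CUP 2021), Prop. 54; A. Polujan, A. Pott,
Des. Codes Cryptogr. 88 (2020), §2].  The conclusion is verbatim `Negative.MMConclusionAt m g`.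

Proof.  Read Bool-vectors as `ZMod 2`-vectors along the indicator map `Negative.ind` (`dnf_ind_*`; the real
character `z ↦ (-1)^z` is written `(-1 : ℝ) ^ z.val`: `dnf_chi_*`, with the dictionary `signOf b = (-1)^[b]`,
`twist x y = (-1)^{⟨ind x, ind y⟩}`).  `V` becomes an `m`-dimensional subspace `S` (`dnf_exists_submodule`,
`dnf_finrank_eq`: `|S| = 2^{dim S}`); a basis of `S` and one of a complement (`Submodule.exists_isCompl`,
`Module.finBasisOfFinrankEq`) give the STRAIGHTENING automorphism `Φ(a ‖ b) = w(b) + Σ_i a_i • v_i`, `v_i ∈ S`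
(`dnf_exists_linearEquiv`); `e := ind⁻¹ ∘ Φ ∘ ind` has matrix `LinearMap.toMatrix' Φ`.  Vanishing second
derivatives make `g` AFFINE along `S` (`dnf_affine`, a finset induction), whence the shape with
`perm y″ i = g(w ⊕ v_i) ⊕ g(w)`, `h y″ = g(w)`, `w = w(y″)`.  Bentness makes `perm` ONTO (`dnf_perm_surjective`): for
`t ∉ range perm`, taking `u` dual to the linear functional `x ↦ ⟨(Φ⁻¹ x)′, t⟩` (`dnf_exists_dual_vector`: every
functional is a dot product), `W_g(u) = Σ_{y″} ± Σ_{y′} (-1)^{⟨y′, perm y″ ⊕ t⟩} = 0` (`sum_twist_left`), contradicting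
`W_g = ±2^m`; onto ⇒ bijective on the finite set `𝔽₂^m`.  The case `m = 0` needs no special treatment.

What is NOT here: where `V` comes from (stubs `stub_local_to_global`, `stub_defect_vanishing` of the line), the bridge
`forrelation f g = 1 ⇒ g bent with dual f` (`stub_dual_of_forrelation`, landed separately), and the (easy, unused)
converse that Maiorana–McFarland functions are bent.
-/

set_option linter.dupNamespace false -- D-0017: single-problem summit ⇒ `QuantumAdvantage.QuantumAdvantage` by design

namespace Summit.QuantumAdvantage.QuantumAdvantage.Theorems.CubicForrelation.ExactPairsMaioranaMcFarland

open Literature.Computability.QuantumComplexity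
open Literature.Computability.QuantumComplexity.BuzetChailloux (bxor)
open Literature.Computability.QuantumComplexity.BuzetChailloux (bxor_eq_zeroVec_iff sum_twist_left)
open Summit.QuantumAdvantage.QuantumAdvantage.Theorems.ExactPairsMaioranaMcFarland.Negative
  (ind ind_injective ind_bx ite_xor)

/-! ### Bool-vectors versus `ZMod 2`-vectors -/

/-- Every `ZMod 2`-vector is an indicator vector: `ind` is surjective (hence bijective, with `ind_injective`). -/
theorem dnf_ind_surjective {n : ℕ} : Function.Surjective (ind (n := n)) := by
  intro v
  refine ⟨fun i => decide (v i = 1), funext fun i => ?_⟩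
  exact (by decide : ∀ a : ZMod 2, (if decide (a = 1) = true then (1 : ZMod 2) else 0) = a) (v i)

/-- `ind` commutes with concatenation of blocks. -/
theorem dnf_ind_append {m k : ℕ} (a : Fin m → Bool) (b : Fin k → Bool) :
    ind (Fin.append a b) = Fin.append (ind a) (ind b) := by
  funext i
  refine Fin.addCases (fun j => ?_) (fun j => ?_) i
  · simp only [ind, Fin.append_left]
  · simp only [ind, Fin.append_right]

/-- If four Booleans xor to `false`, their indicators sum to zero in `ZMod 2`. -/
theorem dnf_ind_xor4 (a b c d : Bool) (h : (a ^^ b ^^ c ^^ d) = false) :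
    (if a then (1 : ZMod 2) else 0) + (if b then (1 : ZMod 2) else 0)
      + (if c then (1 : ZMod 2) else 0) + (if d then (1 : ZMod 2) else 0) = 0 := by
  revert h; cases a <;> cases b <;> cases c <;> cases d <;> decide

/-- `(-1)^(a+b) = (-1)^a (-1)^b` on `ZMod 2`. -/
theorem dnf_chi_add (a b : ZMod 2) :
    (-1 : ℝ) ^ (a + b).val = (-1 : ℝ) ^ a.val * (-1 : ℝ) ^ b.val := by
  have hc : ∀ a : ZMod 2, a = 0 ∨ a = 1 := by decide
  rcases hc a with rfl | rfl <;> rcases hc b with rfl | rfl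
  · simp
  · simp
  · simp
  · rw [show ((1 : ZMod 2) + 1).val = 0 by decide, show (1 : ZMod 2).val = 1 by decide]; norm_num

/-- `(-1)^(Σ_i f i) = ∏_i (-1)^(f i)` on `ZMod 2`. -/
theorem dnf_chi_sum {ι : Type*} (s : Finset ι) (f : ι → ZMod 2) :
    (-1 : ℝ) ^ (∑ i ∈ s, f i).val = ∏ i ∈ s, (-1 : ℝ) ^ (f i).val := by
  classical
  induction s using Finset.induction_on with
  | empty => simp
  | insert i s hi ih => rw [Finset.sum_insert hi, Finset.prod_insert hi, dnf_chi_add, ih]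

/-- `signOf b = (-1)^[b]`. -/
theorem dnf_signOf_eq_chi (p : Bool) :
    signOf p = (-1 : ℝ) ^ (if p then (1 : ZMod 2) else 0).val := by
  cases p
  · simp [signOf]
  · rw [if_pos rfl, show (1 : ZMod 2).val = 1 by decide]; simp [signOf]

/-- `twist x y = (-1)^{⟨ind x, ind y⟩}`: the twist is the character of the `ZMod 2` dot product. -/
theorem dnf_twist_eq_chi {n : ℕ} (a b : Fin n → Bool) :
    twist a b = (-1 : ℝ) ^ (ind a ⬝ᵥ ind b).val := by
  unfold twist dotProduct
  rw [dnf_chi_sum]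
  refine Finset.prod_congr rfl fun i _ => ?_
  simp only [ind]
  cases a i <;> cases b i <;> simp [show (1 : ZMod 2).val = 1 by decide]

/-! ### Linear algebra over `ZMod 2`: the subspace, the straightening automorphism, dual vectors -/

/-- An xor-closed nonempty finset of Bool-vectors is, along `ind`, a `ZMod 2`-subspace of the same size. -/
theorem dnf_exists_submodule {n : ℕ} (V : Finset (Fin n → Bool))
    (hxor : ∀ a ∈ V, ∀ b ∈ V, bxor a b ∈ V) (hne : V.Nonempty) :
    ∃ S : Submodule (ZMod 2) (Fin n → ZMod 2), (∀ x, ind x ∈ S ↔ x ∈ V) ∧ Nat.card S = V.card := by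
  let ι : (Fin n → Bool) ≃ (Fin n → ZMod 2) := Equiv.ofBijective ind ⟨ind_injective, dnf_ind_surjective⟩
  have hι : ∀ x, ι x = ind x := fun _ => rfl
  have hsymm : ∀ x, ι.symm (ind x) = x := fun x => by rw [← hι, Equiv.symm_apply_apply]
  have hbx : ∀ x a : Fin n → Bool, ind (bxor x a) = ind x + ind a := fun x a => ind_bx x a
  have hzero : ι.symm 0 ∈ V := by
    obtain ⟨a, ha⟩ := hne
    have h0 : ind (bxor a a) = 0 := by
      rw [hbx]; funext i; exact CharTwo.add_self_eq_zero _
    rw [← h0, hsymm]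
    exact hxor a ha a ha
  let S : Submodule (ZMod 2) (Fin n → ZMod 2) :=
    { carrier := {v | ι.symm v ∈ V}
      add_mem' := by
        intro v w hv hw
        simp only [Set.mem_setOf_eq] at hv hw ⊢
        have key := hxor _ hv _ hw
        rw [← hsymm (bxor _ _), hbx, ← hι, ← hι, Equiv.apply_symm_apply,
          Equiv.apply_symm_apply] at key
        exact key
      zero_mem' := hzero
      smul_mem' := by
        intro c v hv
        simp only [Set.mem_setOf_eq] at hv ⊢
        rcases (by decide : ∀ a : ZMod 2, a = 0 ∨ a = 1) c with rfl | rfl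
        · rw [zero_smul]; exact hzero
        · rw [one_smul]; exact hv }
  refine ⟨S, fun x => ?_, ?_⟩
  · show ι.symm (ind x) ∈ V ↔ x ∈ V
    rw [hsymm]
  · rw [← Nat.card_eq_finsetCard]
    exact Nat.card_congr (Equiv.subtypeEquiv ι.symm fun v => Iff.rfl)

/-- A `ZMod 2`-subspace with `2^m` elements has dimension `m`. -/
theorem dnf_finrank_eq {n m : ℕ} (S : Submodule (ZMod 2) (Fin n → ZMod 2)) (hS : Nat.card S = 2 ^ m) :
    Module.finrank (ZMod 2) S = m := by
  have h := Module.natCard_eq_pow_finrank (K := ZMod 2) (V := S)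
  rw [hS, Nat.card_zmod] at h
  exact (Nat.pow_right_injective (le_refl 2) h).symm

/-- For an `m`-dimensional subspace `S ≤ 𝔽₂^{m+m}` there is a linear automorphism `Φ` sending the block vector
`a ‖ b` to `w(b) + Σ_i a_i • v_i` with `v_0, …, v_{m-1}` (a basis of) `S`: concatenate a basis of `S` with a basis
of a complement. -/
theorem dnf_exists_linearEquiv (m : ℕ) (S : Submodule (ZMod 2) (Fin (m + m) → ZMod 2))
    (hS : Module.finrank (ZMod 2) S = m) :
    ∃ Φ : (Fin (m + m) → ZMod 2) ≃ₗ[ZMod 2] (Fin (m + m) → ZMod 2),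
      ∃ v : Fin m → (Fin (m + m) → ZMod 2), ∃ w : (Fin m → ZMod 2) → (Fin (m + m) → ZMod 2),
        (∀ i, v i ∈ S) ∧ ∀ a b : Fin m → ZMod 2, Φ (Fin.append a b) = w b + ∑ i, a i • v i := by
  obtain ⟨S', hc⟩ := S.exists_isCompl
  have hS' : Module.finrank (ZMod 2) S' = m := by
    have h1 := Submodule.finrank_add_eq_of_isCompl hc
    rw [hS, Module.finrank_fintype_fun_eq_card, Fintype.card_fin] at h1
    omega
  let bV := Module.finBasisOfFinrankEq (ZMod 2) S hS
  let bW := Module.finBasisOfFinrankEq (ZMod 2) S' hS'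
  let E1 : (Fin (m + m) → ZMod 2) ≃ₗ[ZMod 2] ((Fin m → ZMod 2) × (Fin m → ZMod 2)) :=
    (Fin.appendEquiv m m).symm.toLinearEquiv ⟨fun _ _ => rfl, fun _ _ => rfl⟩
  have hE1 : ∀ a b : Fin m → ZMod 2, E1 (Fin.append a b) = (a, b) := fun a b =>
    (Fin.appendEquiv m m).symm_apply_apply (a, b)
  refine ⟨E1.trans ((bV.equivFun.symm.prodCongr bW.equivFun.symm).trans
      (Submodule.prodEquivOfIsCompl S S' hc)),
    fun i => (bV i : Fin (m + m) → ZMod 2), fun b => ((bW.equivFun.symm b : S') : Fin (m + m) → ZMod 2),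
    fun i => (bV i).2, fun a b => ?_⟩
  rw [LinearEquiv.trans_apply, LinearEquiv.trans_apply, hE1, LinearEquiv.prodCongr_apply,
    Submodule.coe_prodEquivOfIsCompl']
  simp only [Module.Basis.equivFun_symm_apply, Submodule.coe_sum, Submodule.coe_smul]
  exact add_comm _ _

/-- Through a linear automorphism `Φ` of `𝔽₂^{m+m}`, the functional "`⟨first block, t⟩` of the preimage" is a dot
product with a fixed vector `u` (every linear functional on `Fin n → ZMod 2` is one): `⟨Φ(a ‖ b), u⟩ = ⟨a, t⟩`. -/
theorem dnf_exists_dual_vector (m : ℕ) (Φ : (Fin (m + m) → ZMod 2) ≃ₗ[ZMod 2] (Fin (m + m) → ZMod 2))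
    (t : Fin m → ZMod 2) :
    ∃ u : Fin (m + m) → ZMod 2, ∀ a b : Fin m → ZMod 2, Φ (Fin.append a b) ⬝ᵥ u = a ⬝ᵥ t := by
  let ψ : (Fin (m + m) → ZMod 2) →ₗ[ZMod 2] ZMod 2 :=
    { toFun := fun v => (fun i => Φ.symm v (Fin.castAdd m i)) ⬝ᵥ t
      map_add' := fun v w => by
        simp only [map_add]
        exact add_dotProduct (fun i => Φ.symm v (Fin.castAdd m i)) (fun i => Φ.symm w (Fin.castAdd m i)) t
      map_smul' := fun c v => by
        simp only [map_smul, RingHom.id_apply]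
        exact smul_dotProduct c (fun i => Φ.symm v (Fin.castAdd m i)) t }
  have hu : ∀ v, ψ v = v ⬝ᵥ fun j => ψ fun k => if j = k then 1 else 0 := fun v => by
    rw [LinearMap.pi_apply_eq_sum_univ ψ v]; rfl
  refine ⟨fun j => ψ fun k => if j = k then 1 else 0, fun a b => ?_⟩
  rw [← hu]
  show (fun i => Φ.symm (Φ (Fin.append a b)) (Fin.castAdd m i)) ⬝ᵥ t = a ⬝ᵥ t
  rw [LinearEquiv.symm_apply_apply]
  simp only [Fin.append_left]

/-- Reindex a sum over `𝔽₂^{m+m}` by `x = Φ(ind y′ ‖ ind y″)` with Bool blocks `y′, y″`. -/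
theorem dnf_sum_reindex (m : ℕ) (Φ : (Fin (m + m) → ZMod 2) ≃ₗ[ZMod 2] (Fin (m + m) → ZMod 2))
    (F : (Fin (m + m) → ZMod 2) → ℝ) :
    ∑ x, F x = ∑ b : Fin m → Bool, ∑ a : Fin m → Bool, F (Φ (Fin.append (ind a) (ind b))) := by
  let ι : (Fin m → Bool) ≃ (Fin m → ZMod 2) := Equiv.ofBijective ind ⟨ind_injective, dnf_ind_surjective⟩
  let E : (Fin m → Bool) × (Fin m → Bool) ≃ (Fin (m + m) → ZMod 2) :=
    (((Equiv.prodComm _ _).trans (ι.prodCongr ι)).trans (Fin.appendEquiv m m)).trans Φ.toEquiv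
  rw [← Equiv.sum_comp E, Fintype.sum_prod_type]
  rfl

/-- The `ZMod 2`-side character sum `Σ_x (-1)^{G x + ⟨x,u⟩}` is a Walsh coefficient of `g` when `G ∘ ind = g`. -/
theorem dnf_walsh_transport {n : ℕ} (g : (Fin n → Bool) → Bool) (G : (Fin n → ZMod 2) → Bool)
    (hG : ∀ x, G (ind x) = g x) (u : Fin n → ZMod 2) :
    ∃ b : Fin n → Bool, ∑ x : Fin n → ZMod 2, signOf (G x) * (-1 : ℝ) ^ (x ⬝ᵥ u).val =
      DerivativeWalsh.W (fun x => signOf (g x)) b := by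
  obtain ⟨b, rfl⟩ := dnf_ind_surjective u
  refine ⟨b, ?_⟩
  unfold DerivativeWalsh.W
  rw [← Equiv.sum_comp (Equiv.ofBijective ind ⟨ind_injective, dnf_ind_surjective⟩)]
  refine Finset.sum_congr rfl fun x _ => ?_
  rw [Equiv.ofBijective_apply, hG, dnf_twist_eq_chi]

/-- Transport of "all `D_a D_b g ≡ 0` for `a b ∈ V`" to the `ZMod 2` side. -/
theorem dnf_hD_transport {n : ℕ} (g : (Fin n → Bool) → Bool) (G : (Fin n → ZMod 2) → Bool)
    (hG : ∀ x, G (ind x) = g x) (V : Finset (Fin n → Bool)) (S : Submodule (ZMod 2) (Fin n → ZMod 2))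
    (hSV : ∀ x, ind x ∈ S ↔ x ∈ V)
    (hD : ∀ a ∈ V, ∀ b ∈ V, ∀ x : Fin n → Bool,
      (g x ^^ g (bxor x a) ^^ g (bxor x b) ^^ g (bxor (bxor x a) b)) = false) :
    ∀ a ∈ S, ∀ b ∈ S, ∀ x : Fin n → ZMod 2,
      (if G x then (1 : ZMod 2) else 0) + (if G (x + a) then (1 : ZMod 2) else 0)
        + (if G (x + b) then (1 : ZMod 2) else 0) + (if G (x + a + b) then (1 : ZMod 2) else 0) = 0 := by
  intro a' ha' b' hb' x'
  obtain ⟨a, rfl⟩ := dnf_ind_surjective a'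
  obtain ⟨b, rfl⟩ := dnf_ind_surjective b'
  obtain ⟨x, rfl⟩ := dnf_ind_surjective x'
  have hbx : ∀ x a : Fin n → Bool, ind (bxor x a) = ind x + ind a := fun x a => ind_bx x a
  rw [← hbx, ← hbx, ← hbx, hG, hG, hG, hG]
  exact dnf_ind_xor4 _ _ _ _ (hD a ((hSV a).1 ha') b ((hSV b).1 hb') x)

/-- AFFINENESS ALONG THE SUBSPACE.  If all second differences of `γ` in directions of `S` vanish, then along any
family `v_i ∈ S` the value at `w + Σ_{i∈I} v_i` is the affine combination `γ w + Σ_{i∈I} (γ(w + v_i) + γ w)`. -/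
theorem dnf_affine {n : ℕ} {ι : Type*} (S : Submodule (ZMod 2) (Fin n → ZMod 2))
    (γ : (Fin n → ZMod 2) → ZMod 2)
    (hD : ∀ a ∈ S, ∀ b ∈ S, ∀ x, γ x + γ (x + a) + γ (x + b) + γ (x + a + b) = 0)
    (w : Fin n → ZMod 2) (v : ι → Fin n → ZMod 2) (hv : ∀ i, v i ∈ S) (I : Finset ι) :
    γ (w + ∑ i ∈ I, v i) = γ w + ∑ i ∈ I, (γ (w + v i) + γ w) := by
  classical
  induction I using Finset.induction_on with
  | empty => simp
  | insert i I hi ih =>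
    rw [Finset.sum_insert hi, Finset.sum_insert hi, ← add_assoc w]
    have key := hD (v i) (hv i) (∑ j ∈ I, v j) (S.sum_mem fun j _ => hv j) w
    rw [ih] at key
    have fact : ∀ p q T s : ZMod 2, p + q + (p + T) + s = 0 → s = p + ((q + p) + T) := by decide
    exact fact _ _ _ _ key

/-! ### Dillon's normal form: the shape from affineness, the permutation from bentness -/

/-- If `G ∘ Φ` has the Maiorana–McFarland shape `⟨y′, P y″⟩ + h(y″)` for SOME map `P` and all character sums
`Σ_x (-1)^{G x + ⟨x,u⟩}` are non-zero (bentness), then `P` is onto: for `t ∉ range P` the character sum at the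
vector `u` dual to `y ↦ ⟨y′, t⟩` would be `Σ_{y″} ± Σ_{y′} (-1)^{⟨y′, P y″ ⊕ t⟩} = 0`. -/
theorem dnf_perm_surjective (m : ℕ) (G : (Fin (m + m) → ZMod 2) → Bool)
    (Φ : (Fin (m + m) → ZMod 2) ≃ₗ[ZMod 2] (Fin (m + m) → ZMod 2))
    (P : (Fin m → Bool) → (Fin m → Bool)) (h : (Fin m → Bool) → Bool)
    (hMM : ∀ y' y'' : Fin m → Bool,
      (if G (Φ (Fin.append (ind y') (ind y''))) then (1 : ZMod 2) else 0) =
        (∑ i, (if y' i then (1 : ZMod 2) else 0) * (if P y'' i then (1 : ZMod 2) else 0)) +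
          (if h y'' then (1 : ZMod 2) else 0))
    (hbent : ∀ u, ∑ x, signOf (G x) * (-1 : ℝ) ^ (x ⬝ᵥ u).val ≠ 0) :
    Function.Surjective P := by
  intro t
  by_contra ht
  push Not at ht
  obtain ⟨u, hu⟩ := dnf_exists_dual_vector m Φ (ind t)
  apply hbent u
  rw [dnf_sum_reindex m Φ]
  refine Finset.sum_eq_zero fun y'' _ => ?_
  have inner : ∀ y' : Fin m → Bool,
      signOf (G (Φ (Fin.append (ind y') (ind y'')))) *
          (-1 : ℝ) ^ (Φ (Fin.append (ind y') (ind y'')) ⬝ᵥ u).val =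
        signOf (h y'') * twist y' (bxor (P y'') t) := by
    intro y'
    rw [hu, dnf_signOf_eq_chi, hMM, dnf_signOf_eq_chi (h y''), dnf_twist_eq_chi, ← dnf_chi_add,
      ← dnf_chi_add]
    have h1 : (∑ i, (if y' i then (1 : ZMod 2) else 0) * (if P y'' i then (1 : ZMod 2) else 0)) =
        ind y' ⬝ᵥ ind (P y'') := rfl
    have hexp : (∑ i, (if y' i then (1 : ZMod 2) else 0) * (if P y'' i then (1 : ZMod 2) else 0)) +
        (if h y'' then (1 : ZMod 2) else 0) + ind y' ⬝ᵥ ind t =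
        (if h y'' then (1 : ZMod 2) else 0) + ind y' ⬝ᵥ ind (bxor (P y'') t) := by
      rw [h1, show ind (bxor (P y'') t) = ind (P y'') + ind t from ind_bx _ _, dotProduct_add]
      abel
    rw [hexp]
  calc ∑ y' : Fin m → Bool, signOf (G (Φ (Fin.append (ind y') (ind y'')))) *
          (-1 : ℝ) ^ (Φ (Fin.append (ind y') (ind y'')) ⬝ᵥ u).val
      = ∑ y' : Fin m → Bool, signOf (h y'') * twist y' (bxor (P y'') t) :=
        Finset.sum_congr rfl fun y' _ => inner y'
    _ = 0 := by
        rw [← Finset.mul_sum, sum_twist_left,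
          if_neg (fun h0 => ht y'' ((bxor_eq_zeroVec_iff _ _).1 h0)), mul_zero]

/-- **Dillon's normal-form theorem** (Dillon 1974; Carlet 2021, Prop. 54; Polujan–Pott 2020, §2), in the crux's own
vocabulary.  Let `g` on `m + m` bits be bent with dual `f` (`W_g(b) = 2^m (-1)^{f(b)}` for all `b`) and affine on
every coset of an xor-closed `V` with `|V| = 2^m` (all second derivatives `D_a D_b g`, `a b ∈ V`, vanish).  Then there
is a LINEAR bijection `e` of `𝔽₂^{m+m}` (given with its matrix, translation part `0`), a PERMUTATION `perm` of `𝔽₂^m`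
and `h : 𝔽₂^m → 𝔽₂` with `g(e(y′ ‖ y″)) = ⟨y′, perm y″⟩ + h(y″)`: `g` is completed Maiorana–McFarland.
Proof: straighten `V` onto the `y′`-block by a basis of `V` and of a complement (`dnf_exists_linearEquiv`); along `V`
the function is affine (`dnf_affine`), which gives the shape with `perm y″ i = g(w ⊕ v_i) ⊕ g(w)`, `h y″ = g(w)`,
`w = e(0 ‖ y″)`; bentness forces `perm` to be onto (`dnf_perm_surjective`), hence a bijection of the finite set. -/
theorem stub_dillon_normal_form :
    ∀ (m : ℕ) (f g : (Fin (m + m) → Bool) → Bool),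
      (∀ b : Fin (m + m) → Bool,
        DerivativeWalsh.W (fun x => signOf (g x)) b = (2 : ℝ) ^ m * signOf (f b)) →
      (∃ V : Finset (Fin (m + m) → Bool), (∀ a ∈ V, ∀ b ∈ V, bxor a b ∈ V) ∧ V.card = 2 ^ m ∧
        ∀ a ∈ V, ∀ b ∈ V, ∀ x : Fin (m + m) → Bool,
          (g x ^^ g (bxor x a) ^^ g (bxor x b) ^^ g (bxor (bxor x a) b)) = false) →
      ∃ e : (Fin (m + m) → Bool) ≃ (Fin (m + m) → Bool),
        (∃ M : Matrix (Fin (m + m)) (Fin (m + m)) (ZMod 2), ∃ c : Fin (m + m) → ZMod 2,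
          ∀ y i, (if e y i then (1 : ZMod 2) else 0) =
            (M.mulVec (fun j => if y j then (1 : ZMod 2) else 0) + c) i) ∧
        ∃ perm : (Fin m → Bool) ≃ (Fin m → Bool), ∃ h : (Fin m → Bool) → Bool,
          ∀ y' y'' : Fin m → Bool,
            (if g (e (Fin.append y' y'')) then (1 : ZMod 2) else 0) =
              (∑ i, (if y' i then (1 : ZMod 2) else 0) * (if perm y'' i then (1 : ZMod 2) else 0)) +
                (if h y'' then (1 : ZMod 2) else 0) := by
  intro m f g hW hV
  obtain ⟨V, hVx, hVc, hD⟩ := hV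
  -- the Bool / `ZMod 2` dictionary on `m + m` bits and the pulled-back function `G`
  obtain ⟨ιn, hι⟩ : ∃ ι : (Fin (m + m) → Bool) ≃ (Fin (m + m) → ZMod 2), ∀ x, ι x = ind x :=
    ⟨Equiv.ofBijective ind ⟨ind_injective, dnf_ind_surjective⟩, fun _ => rfl⟩
  have hι' : ∀ v, ind (ιn.symm v) = v := fun v => by rw [← hι, Equiv.apply_symm_apply]
  obtain ⟨G, hG, hGι⟩ : ∃ G : (Fin (m + m) → ZMod 2) → Bool,
      (∀ x, G (ind x) = g x) ∧ ∀ v, g (ιn.symm v) = G v :=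
    ⟨fun v => g (ιn.symm v), fun x => by
      show g (ιn.symm (ind x)) = g x
      rw [← hι, Equiv.symm_apply_apply], fun _ => rfl⟩
  -- the subspace `S` (= `V` read in `ZMod 2`), of dimension `m`, and the straightening automorphism `Φ`
  have hne : V.Nonempty := Finset.card_pos.1 (by rw [hVc]; exact Nat.two_pow_pos m)
  obtain ⟨S, hSV, hScard⟩ := dnf_exists_submodule V hVx hne
  have hSm : Module.finrank (ZMod 2) S = m := dnf_finrank_eq S (by rw [hScard, hVc])
  obtain ⟨Φ, bV, w, hbV, hΦ⟩ := dnf_exists_linearEquiv m S hSm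
  have hD' := dnf_hD_transport g G hG V S hSV hD
  -- the Maiorana–McFarland data: `P y″ i = G(w ⊕ v_i) ⊕ G(w)`, `h y″ = G w`, `w = w(y″)`
  obtain ⟨P, hP⟩ : ∃ P : (Fin m → Bool) → (Fin m → Bool),
      ∀ y'' i, P y'' i = (G (w (ind y'') + bV i) ^^ G (w (ind y''))) := ⟨_, fun _ _ => rfl⟩
  have hpt : ∀ y' y'' : Fin m → Bool, Φ (Fin.append (ind y') (ind y'')) =
      w (ind y'') + ∑ i ∈ Finset.univ.filter (fun i => y' i = true), bV i := by
    intro y' y''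
    rw [hΦ, Finset.sum_filter]
    congr 1
    refine Finset.sum_congr rfl fun i _ => ?_
    simp only [ind, ite_zero_smul, one_smul]
  have hMM : ∀ y' y'' : Fin m → Bool,
      (if G (Φ (Fin.append (ind y') (ind y''))) then (1 : ZMod 2) else 0) =
        (∑ i, (if y' i then (1 : ZMod 2) else 0) * (if P y'' i then (1 : ZMod 2) else 0)) +
          (if G (w (ind y'')) then (1 : ZMod 2) else 0) := by
    intro y' y''
    have key := dnf_affine S (fun v => if G v then (1 : ZMod 2) else 0) hD' (w (ind y'')) bV hbV
      (Finset.univ.filter fun i => y' i = true)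
    beta_reduce at key
    rw [hpt, key, add_comm (if G (w (ind y'')) then (1 : ZMod 2) else 0), Finset.sum_filter]
    congr 1
    refine Finset.sum_congr rfl fun i _ => ?_
    rw [boole_mul, hP, ite_xor]
  -- bentness on the `ZMod 2` side, and bijectivity of `P`
  have hbent : ∀ u, ∑ x, signOf (G x) * (-1 : ℝ) ^ (x ⬝ᵥ u).val ≠ 0 := by
    intro u
    obtain ⟨b, hb⟩ := dnf_walsh_transport g G hG u
    rw [hb, hW b]
    have hs : signOf (f b) ≠ 0 := by cases f b <;> simp [signOf]
    exact mul_ne_zero (pow_ne_zero _ two_ne_zero) hs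
  have hbij : Function.Bijective P :=
    Finite.surjective_iff_bijective.1 (dnf_perm_surjective m G Φ P (fun y'' => G (w (ind y''))) hMM hbent)
  refine ⟨ιn.trans (Φ.toEquiv.trans ιn.symm), ⟨LinearMap.toMatrix' Φ.toLinearMap, 0, fun y i => ?_⟩,
    Equiv.ofBijective P hbij, fun y'' => G (w (ind y'')), fun y' y'' => ?_⟩
  · -- `e` is linear with matrix `toMatrix' Φ` and translation `0`
    rw [add_zero, LinearMap.toMatrix'_mulVec]
    show ind (ιn.symm (Φ (ιn y))) i = Φ (ind y) i
    rw [hι', hι]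
  · -- the normal form
    show (if g (ιn.symm (Φ (ιn (Fin.append y' y'')))) then (1 : ZMod 2) else 0) = _
    rw [hGι, hι, dnf_ind_append, hMM]
    rfl

end Summit.QuantumAdvantage.QuantumAdvantage.Theorems.CubicForrelation.ExactPairsMaioranaMcFarland
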